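/-
Copyright: lit-balaban Phase-2 proof seat p08 (gen 7).  Statement-level skeleton of a published paper; no proof claims beyond what
the kernel checks below.
-/
import Literature.MathematicalPhysics.QuantumFieldTheory.BalabanImbrieJaffe1984to88.BIJ88SigmaKernelDkTorus

/-!
# `BalabanImbrieJaffe1984to88.BIJ88Decay216Torus` — T. Bałaban, J. Imbrie, A. Jaffe, *Effective action and cluster properties of the
abelian Higgs model*, Commun. Math. Phys. **114** (1988) 257–315 [BalabanImbrieJaffe1988]: **(2.16)** p. 261 — the exponential decay of the
kernel of σ_k — **ON THE TORI OF THE SERIES FOR p30's `sigmaTorus`**, from the two §7.2 kernel estimates of [I] = [BalabanImbrieJaffe1985]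
the print cites through *"properties of H_k, 𝒟_k"*: the gradient member of (7.2.2) for the Landau minimizers `H_j` (r15's typed
`KernelData.Ineq722` for p09's torus kernel family, i.e. [6I] Proposition 1.2 by its tree name) and (7.2.3) for the unit-lattice propagators
`C^{(j)}` (the matrix of p11's `CE`), via the multiscale representation of the kernel landed in `BIJ88SigmaKernelDkTorus` and the bracketed
mechanism p. 261 *"[The rapid decay of the terms with small j compensates for the scaling factors (L^jη)^{−1}.]"* — with constants
INDEPENDENT of `k` and of the volume, in the three-constant shape (threshold, prefactor, rate) consumed by gen 7's (2.17) files

statement-level skeleton of published theorems with citation tags; proofs where landed; nothing here is a claim about the Yang–Mills mass gap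

PDF held: `paper:balaban1988-cmp114-bij-abelian-higgs-effective-action` (journal page = PDF page + 256), p. 261 [PDF 5]; [I] p. 325 [PDF 27].

CITATION HEADER (lean-in-tree rule).  Part of the lit-balaban TYPED SKELETON (HOME `run/shared/lean/pub/lit-balaban/`), Phase-2 proof
seat p08 (gen 7), unit `lit-balaban-p08`; WHAT IS REPRODUCED = SKELETON row **C2.Eq2.16** (owner r18, referee ref-5), kind «model instance»
for the torus σ_k, joined to rows **C1.Eq7.2.1-7.2.2** and **C1.Eq7.2.3** (owner r15).  TAKING line HOME/STATUS.md (gen 7, tenth target).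

THE PRINTED TEXT (p. 261 [PDF 5], verbatim): *"The properties of σ_k follow from (2.13) and properties of H_k, 𝒟_k, so that |σ_k(p₁,p₂)| ≦
ce^{−c dist(p₁,p₂)} for dist(p₁,p₂) ≧ c. (2.16) [The rapid decay of the terms with small j compensates for the scaling factors (L^jη)^{−1}.]"*;
[I] p. 325: *"The kernel H_{k,μν}(x,y) and its gradient decay exponentially … (7.2.2) … The unit lattice propagator C^{(k)} also has exponential
decay, |C^{(k)}_{μν}(x,y)| ≦ Me^{−δ|x−y|}, (7.2.3) for x, y ∈ T₁^{(k)}."*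

THE INPUTS (hypotheses, in the shape of the typed rows).  (a) the gradient member of (7.2.2) at every scale `j`, two constants `(δ, M)`, for
the `|∇H|` member of p09's carrier `torusKernelData P j (deltaAData hj a) …` in the fine-site distance `distEU P j` — §6 takes it from r15's
typed `KernelData.Ineq722` for the family of scales (`BIJ88Ineq217Ineq722Torus.exists_bound_of_ineq722`), hence from `B5.Prop12Printed`;
(b) (7.2.3) at every scale `j < k` for THE MATRIX `C^{(j)}(b, b′) = ⟨e_b, C^{(j)}e_{b′}⟩` of p11's `CE P w c j` in the orthonormal basis of the
`T^{(j)}` bond space (the unit-lattice pairing of (7.2.3)), distance `|b₋ − b′₋|_∞` on `T^{(j)}`, constants `(M_C, δ_C)` uniform in `j`.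

WHAT IS PROVED (0 `sorry`, standard axioms; theorems only — proof lane; `k ≤ m + K`, `w > 0`, `c ≠ 0`, `2 ≤ d`):
* §1 geometry of the faces: `iterBlockOf_eq_of_mem_edgeB` (a fine plaquette of the face `B^e_k(p)` has its k-block at `p`), `supDist_ctr_le_of_mem`
  (it lies within `(L^k−1)/2` of the block centre), `distEU_sub_le` (the fine-site distance is 1-Lipschitz in `x` in the unit `L^j`).
* §2 the columns: `abs_curl_col_le` — `|(∂^{c′}H_je_b)(q)| ≤ (|c′|/L^j)·2M·e^{−δ|q − y|}` from the gradient member of (7.2.2) at scale `j`.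
* §3 lattice sums (`sum_bond_src`, `scaleFactor_le`, `sum_inv_pow_le_one` of §§4–5 are private plumbing): `sum_exp_neg_distEU_le` (`Σ_y e^{−a|x − y|} ≤ e^{a/2}(2(1 + d/a))^d`), `triple_sum_le` (two `H`-columns and one
  `C`-kernel: `Σ_{y,y′} e^{−δ|x₁−y|}e^{−δ_C|y−y′|}e^{−δ|x₂−y′|} ≤ e^{a/2}K(a)²·e^{−a|x₁−x₂|_∞/L^j}`, `a = min(δ,δ_C)/2`, through the block centres).
* §4 the scale-`j` term: `abs_cellsQ_le_of_mem`, `abs_coord_le` (`|u^{(j)}_p(b)| ≤ (w·η^{−d})(|c|/L^j)2Me^{δL^{k−j}}e^{−δ|y_p − b₋|}`, `y_p`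
  the centre of the block of `p`), `sum_bond_src`, **`abs_term_le`** — `|Σ_{b,b′} u^{(j)}_{p₁}(b)C^{(j)}(b,b′)u^{(j)}_{p₂}(b′)| ≤
  A·(|c|/L^j)²·e^{2δL^{k−j}}·e^{−aL^{k−j}D}`, `D = |p₁ − p₂|_∞` on `T^{(k)}`, `A = (w·η^{−d})²·4M²M_C·d²·e^{a/2}K(a)²` — the edge averages over
  the two faces cost `e^{δL^{k−j}}` each (face diameter `L^{k−j}` in the unit of `T^{(j)}`), the block centres are `L^{k−j}D` apart.
* §5 the multiscale sum: `scaleFactor_le` (`L^{2n}e^{−aL^n} ≤ 6/(a³L^n)`), `sum_inv_pow_le_one` (`Σ_{j<k} L^{−(k−j)} ≤ 1`), and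
  **`abs_sigmaKernel_le`** — for `D ≥ 4δ/a + 2`: `|σ_k(p₁, p₂)| ≤ (w·η^{−d})²(|c|/L^k)²·(24M²M_C·d²e^{a/2}K(a)²/a³)·e^{−(a/2)D}` — print's
  bracketed mechanism: the factor `(|c|/L^j)² = (|c|/L^k)²L^{2(k−j)}` of the two derivatives against the decay `e^{−aL^{k−j}}` of the scale-`j`
  kernels (`e^{2δL^{k−j}}e^{−aL^{k−j}D} ≤ e^{−aL^{k−j}}e^{−(a/2)D}` in the far regime).
* §6 **(2.16) ON THE TORI**: `cBound_of_ineq723` (the (7.2.3)-shape hypothesis = r15's typed `KernelData.Ineq723` for p09's carrier with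
  `C` := the matrix of p11's `CE`), `decay216_torus_eta` (at `w = η^d`, `c = η⁻¹`, in the `ℓ¹` distance `pdist` of gen 6's files and the three-constant
  shape `R ≤ pdist p₁ p₂ → |σ_k(p₁,p₂)| ≤ c₀e^{−δ′·pdist p₁ p₂}` consumed by `BIJ88Ineq217GradKernel`/`…Ineq722Torus`, constants independent of
  `k` and of the volume), `decay216_torus_of_ineq722` (input (a) from r15's typed `KernelData.Ineq722`), `decay216_torus_of_prop12` (from
  `B5.Prop12Printed`).
* §7 **(2.17) ON THE TORI WITH (2.16) DISCHARGED**: `sum_plaq_exp_neg_pdist_le` (plaquette row sums) and **`ineq217_torus_of_prop12`** — gen 7's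
  `abs_ineq217_ineq722_torus` fed with `decay216_torus_of_ineq722`: `|(σ_kf)(p₁)| ≤ C(1 + R)‖f‖_∞` for curls `f = ∂A` on the box of radius
  `R ≥ R₀` about `p₁`, ONE pair `(R₀, C)` for all scales, given only `B5.Prop12Printed` and (7.2.3).
HONEST SCOPE.  (i) (7.2.3) enters as a hypothesis on the matrix of p11's `CE P w c j` at the weights of the ambient scale `k` (the `C^{(j)}` of
(4.4.4)/(5.2.2) as landed), uniformly in `j < k` — the typed row C1.Eq7.2.3 (`KernelData.Ineq723`) has no torus instance in the tree; (ii) the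
(2.13)-route of the print (through `𝒟_{k,loc}`) is replaced by the direct multiscale sum over (4.4.4) (same mechanism, bracketed sentence);
(iii) constants explicit, not optimal; threshold in the `ℓ^∞` block distance, restated in `pdist`; (iv) `U = 1` real abelian fields, torus,
standing range; no `def`, no new named fact; NOT summit progress.  Unit `lit-balaban-p08` (literature-prover-lit-balaban-p08-g7-0), 2026-08-21.
-/

open scoped BigOperators RealInnerProductSpace

namespace Literature.MathematicalPhysics.QuantumFieldTheory.BalabanImbrieJaffe1984to88.BIJ88Decay216Torus

open Balaban1983to89 hiding Site Plaq
open Balaban1983to89.LatticeFieldCalculus Balaban1983to89.B5Eq118OneStroke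
open Balaban1983to89.B3TorusRadialSums (sum_exp_neg_supDist_le supDist_comm supDist_eq_zero_iff tdist_le_mul_supDist)
open Balaban1983to89.B7SectAStatements (blockOfIter)
open Balaban1983to89.T4AxialGaugeSmallField (castSite boxPlaqs)
open BIJ88SigmaKernelDkTorus BIJ88Ineq217Ineq722Torus BIJ88Ineq217NearPart
open BIJ88Sect2Statements (supNorm)
open BIJ88Close235Proof (supNorm_nonneg)
open BIJ85AxialPropagator411 BIJ85Prop521Torus BIJ85Sigma421Torus BIJ85Prop522Torus BIJ85Sigma422Eta BIJ85CellAverages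
open BIJ85Eq224Base0 (torusEdgeCellsTo torusBlockBondsTo blk_base0 card_edgeBTo)
open BIJ85Sect7Statements BIJ85Ineq722Torus BIJ85Eq721MinimizerKernel
open BIJ85Ineq722ProofPart2 (settingOf)
open BIJ85Ineq722DeltaA (deltaAData ineq722_deltaA_of_prop12Printed)
open BIJ85Ineq724Torus (supDist_blk_le_distEU)
open B6SectAOntoV1 (blk_eq_iterBlockOf)
open BIJ85GaugeFunction5113 (blk)
-- inside this namespace the bare `Site`/`Plaq` are the `ℤ^d` carriers of the QFT root; the torus ones are renamed:
open Balaban1983to89 renaming Site → TSite, Plaq → TPlaq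

noncomputable section

variable {P : Params}

/-- `0 < L^k` in `ℝ`. [folklore] -/
private theorem cast_pow_L_pos' (k : ℕ) : (0 : ℝ) < (P.L : ℝ) ^ k := pow_pos P.cast_L_pos k

/-! ## §1  Geometry of the faces `B^e_k(p)` -/

/-- **a fine plaquette of the face `B^e_k(p)` has its k-block at `p`**: `q ∈ B^e_k(p) ⇒ x_k(q₋) = p₋` (p31's edge geometry
`torusEdgeCellsTo P 0 k k`: the cell of `q` is the coarse plaquette at the k-fold block point of `q.src`; `blk_base0`).
[cite: BalabanImbrieJaffe1985, (2.21) p.305] -/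
theorem iterBlockOf_eq_of_mem_edgeB (hd : 2 ≤ P.d) {k : ℕ} {p : TPlaq P k} {q : TPlaq P 0}
    (h : q ∈ (torusEdgeCellsTo P 0 k k (Nat.zero_add k) hd).B p) : iterBlockOf k q.src = p.src := by
  rw [Cells.mem_B] at h
  dsimp only [torusEdgeCellsTo] at h
  split_ifs at h with hc
  have h1 := Option.some.inj h
  rw [← h1, ← blk_base0 k q.src]

/-- **a fine plaquette of the face lies within `(L^k − 1)/2` of the centre of the block of `p`** (`|x − y_x|_∞ ≤ (L^k−1)/2`).
[cite: BalabanImbrieJaffe1985, (2.21) p.305] -/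
theorem supDist_ctr_le_of_mem (hd : 2 ≤ P.d) {k : ℕ} (hk : k ≤ P.m + P.K) {p : TPlaq P k} {q : TPlaq P 0}
    (h : q ∈ (torusEdgeCellsTo P 0 k k (Nat.zero_add k) hd).B p) : supDist q.src (ctr k p.src) ≤ (P.L ^ k - 1) / 2 := by
  rw [← iterBlockOf_eq_of_mem_edgeB hd h]
  exact supDist_ctr_blk_le hk q.src

/-- **the fine-site distance `|x − y| = |x − ctr y|_∞/L^j` is 1-Lipschitz in `x` in the unit `L^j`**: `|x − y| − |x′ − y| ≤ |x − x′|_∞/L^j`.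
[cite: BalabanImbrieJaffe1985, (7.2.2) p.325] -/
theorem distEU_sub_le (j : ℕ) (x x' : TSite P 0) (y : TSite P j) :
    distEU P j x' y - distEU P j x y ≤ (supDist x x' : ℝ) / (P.L : ℝ) ^ j := by
  rw [distEU, distEU, ← sub_div]
  refine div_le_div_of_nonneg_right ?_ (cast_pow_L_pos' j).le
  have h := supDist_triangle x' x (ctr j y)
  rw [supDist_comm x' x] at h
  have h' : (supDist x' (ctr j y) : ℝ) ≤ (supDist x x' : ℝ) + (supDist x (ctr j y) : ℝ) := by exact_mod_cast h
  linarith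

/-- `0 ≤ |x − y|`. [folklore] -/
private theorem distEU_nonneg (j : ℕ) (x : TSite P 0) (y : TSite P j) : 0 ≤ distEU P j x y :=
  div_nonneg (Nat.cast_nonneg _) (cast_pow_L_pos' j).le

/-- **the block centres realize the coarse distance**: `|ctr q − ctr q′|_∞/L^j = L^{k−j}·|q − q′|_∞` for `q, q′ ∈ T^{(k)}`, `j ≤ k`
(`supDist_ctr_ctr`). [cite: Balaban1987RG1, (0.1) p.251] -/
theorem supDist_ctr_ctr_div {j k : ℕ} (hjk : j ≤ k) (hk : k ≤ P.m + P.K) (q q' : TSite P k) :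
    (supDist (ctr k q) (ctr k q') : ℝ) / (P.L : ℝ) ^ j = (P.L : ℝ) ^ (k - j) * (supDist q q' : ℝ) := by
  rw [supDist_ctr_ctr hk, Nat.cast_mul, Nat.cast_pow, div_eq_iff (cast_pow_L_pos' j).ne']
  rw [mul_comm ((P.L : ℝ) ^ (k - j)), mul_assoc, ← pow_add, Nat.sub_add_cancel hjk, mul_comm]

/-! ## §2  The columns `∂^{c′}H_je_b` -/

/-- the curl is homogeneous in its lattice factor: `∂^{c′} = (c′/L^j)·∂^{L^j}`. [cite: Balaban1984PropagatorsI, (1.2) p.18] -/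
theorem curl_eq_div_mul (j : ℕ) (c' : ℝ) (A : VecField P 0 ℝ) (q : TPlaq P 0) :
    curl c' A q = c' / (P.L : ℝ) ^ j * curl ((P.L : ℝ) ^ j) A q := by
  simp only [curl, smul_eq_mul]
  rw [← mul_assoc, div_mul_cancel₀ _ (cast_pow_L_pos' j).ne']

/-- **`|(∂^{c′}H_je_b)(q)| ≤ (|c′|/L^j)·2M·e^{−δ|q₋ − b₋|}`** for the column of the scale-`j` Landau minimizer at the unit bond `b ∈ T^{(j)}`,
from the gradient member of (7.2.2) at scale `j` with constants `(δ, M)` (`BIJ88Ineq217Ineq722Torus.abs_curl_HkE_single_le_gradH` at `∂^{L^j}`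
and the homogeneity of the curl). [cite: BalabanImbrieJaffe1985, (7.2.2) p.325] -/
theorem abs_curl_col_le {j : ℕ} (hj : j ≤ P.m + P.K) {c : ℝ} (hc : c ≠ 0) {w : ℝ} (hw : 0 < w) {a : ℝ} (ha : 0 < a) {δ M : ℝ}
    (hB : ∀ (μ ν : Fin P.d) (x : TSite P 0) (y : TSite P j),
      ‖fun lam : Fin P.d => (P.L : ℝ) ^ j *
          ((torusRep P j (deltaAData hj a)).H (x.shift lam, μ) (y, ν) - (torusRep P j (deltaAData hj a)).H (x, μ) (y, ν))‖ ≤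
        M * Real.exp (-(δ * distEU P j x y)))
    (c' : ℝ) (q : TPlaq P 0) (b : PBond P j) :
    |curl c' (WithLp.ofLp (HkE P w c j (toEj P j (Pi.single b 1)))) q| ≤
      |c'| / (P.L : ℝ) ^ j * (2 * M) * Real.exp (-(δ * distEU P j q.src b.src)) := by
  rw [curl_eq_div_mul j c', abs_mul, abs_div, abs_of_pos (cast_pow_L_pos' j), mul_assoc]
  refine mul_le_mul_of_nonneg_left ?_ (div_nonneg (abs_nonneg _) (cast_pow_L_pos' j).le)
  have h := abs_curl_HkE_single_le_gradH hj hc hw ha PUnit (fun _ _ => 0) (fun _ _ _ _ => 0) (fun _ _ => 0) b q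
  rw [torusKernelData_gradH, torusKernelData_gradH] at h
  calc |curl ((P.L : ℝ) ^ j) (WithLp.ofLp (HkE P w c j (toEj P j (Pi.single b 1)))) q|
      ≤ _ := h
    _ ≤ M * Real.exp (-(δ * distEU P j q.src b.src)) + M * Real.exp (-(δ * distEU P j q.src b.src)) :=
        add_le_add (hB _ _ _ _) (hB _ _ _ _)
    _ = 2 * M * Real.exp (-(δ * distEU P j q.src b.src)) := by ring

/-! ## §3  Lattice sums -/

/-- **`Σ_{y∈T^{(j)}} e^{−a|x − y|} ≤ e^{a/2}·(2(1 + d/a))^d`** for the fine-site distance, uniformly in the volume and in `j ≤ m + K`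
(`|x_j − y|_∞ ≤ |x − y| + ½`, `BIJ85Ineq724Torus.supDist_blk_le_distEU`; `B3TorusRadialSums.sum_exp_neg_supDist_le`).
[cite: Balaban1983Higgs3, (2.15) p.427] -/
theorem sum_exp_neg_distEU_le {j : ℕ} (hj : j ≤ P.m + P.K) {a : ℝ} (ha : 0 < a) (x : TSite P 0) :
    ∑ y : TSite P j, Real.exp (-(a * distEU P j x y)) ≤ Real.exp (a / 2) * (2 * (1 + P.d / a)) ^ P.d := by
  have hd : 0 < P.d := by have := P.hd; omega
  calc ∑ y : TSite P j, Real.exp (-(a * distEU P j x y))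
      ≤ ∑ y : TSite P j, Real.exp (a / 2) * Real.exp (-(a * (supDist (blk j x) y : ℝ))) := by
        refine Finset.sum_le_sum fun y _ => ?_
        rw [← Real.exp_add]
        refine Real.exp_le_exp.2 ?_
        have h := supDist_blk_le_distEU hj x y
        nlinarith
    _ = Real.exp (a / 2) * ∑ y : TSite P j, Real.exp (-(a * (supDist (blk j x) y : ℝ))) := by rw [Finset.mul_sum]
    _ ≤ Real.exp (a / 2) * (2 * (1 + P.d / a)) ^ P.d :=
        mul_le_mul_of_nonneg_left (sum_exp_neg_supDist_le ha hd (blk j x)) (Real.exp_pos _).le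

/-- **the three-kernel lattice sum through the block centres**: for fine sites `x₁, x₂` and rates `δ, δ_C > 0`, `a := min(δ, δ_C)/2`,
`Σ_{y,y′∈T^{(j)}} e^{−δ|x₁ − y|}e^{−δ_C|y − y′|_∞}e^{−δ|x₂ − y′|} ≤ e^{a/2}K(a)²·e^{−a|x₁ − x₂|_∞/L^j}`, `K(a) = (2(1 + d/a))^d` — the triangle
inequality `|x₁ − x₂|_∞ ≤ L^j(|x₁ − y| + |y − y′|_∞ + |x₂ − y′|)` through `ctr y`, `ctr y′` takes half of each rate, the row sums the rest.
[cite: Balaban1983Higgs3, (2.15) p.427] -/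
theorem triple_sum_le {j : ℕ} (hj : j ≤ P.m + P.K) {δ δC : ℝ} (hδ : 0 < δ) (hδC : 0 < δC) (x₁ x₂ : TSite P 0) :
    ∑ y : TSite P j, ∑ y' : TSite P j, Real.exp (-(δ * distEU P j x₁ y)) * Real.exp (-(δC * (supDist y y' : ℝ))) *
        Real.exp (-(δ * distEU P j x₂ y')) ≤
      Real.exp (min δ δC / 2 / 2) * ((2 * (1 + P.d / (min δ δC / 2))) ^ P.d) ^ 2 *
        Real.exp (-(min δ δC / 2 * ((supDist x₁ x₂ : ℝ) / (P.L : ℝ) ^ j))) := by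
  set a : ℝ := min δ δC / 2 with ha_def
  have ha : 0 < a := by rw [ha_def]; exact half_pos (lt_min hδ hδC)
  have haδ : 2 * a ≤ δ := by rw [ha_def]; linarith [min_le_left δ δC]
  have haC : 2 * a ≤ δC := by rw [ha_def]; linarith [min_le_right δ δC]
  have hd : 0 < P.d := by have := P.hd; omega
  set D : ℝ := (supDist x₁ x₂ : ℝ) / (P.L : ℝ) ^ j with hD
  -- pointwise: the product is at most `e^{−aD}·e^{−a|x₁−y|}·e^{−a|y−y′|}`
  have hpt : ∀ y y' : TSite P j,
      Real.exp (-(δ * distEU P j x₁ y)) * Real.exp (-(δC * (supDist y y' : ℝ))) * Real.exp (-(δ * distEU P j x₂ y')) ≤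
        Real.exp (-(a * D)) * (Real.exp (-(a * distEU P j x₁ y)) * Real.exp (-(a * (supDist y y' : ℝ)))) := by
    intro y y'
    rw [← Real.exp_add, ← Real.exp_add, ← Real.exp_add, ← Real.exp_add]
    refine Real.exp_le_exp.2 ?_
    have h1 := distEU_nonneg j x₁ y
    have h2 := distEU_nonneg j x₂ y'
    have h3 : (0 : ℝ) ≤ (supDist y y' : ℝ) := Nat.cast_nonneg _
    -- triangle inequality through the centres
    have htri : D ≤ distEU P j x₁ y + (supDist y y' : ℝ) + distEU P j x₂ y' := by
      have hL := cast_pow_L_pos' (P := P) j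
      rw [hD, div_le_iff₀ hL]
      have t1 := supDist_triangle x₁ (ctr j y) x₂
      have t2 := supDist_triangle (ctr j y) (ctr j y') x₂
      rw [supDist_comm (ctr j y') x₂, supDist_ctr_ctr hj] at t2
      have t3 : (supDist x₁ x₂ : ℝ) ≤
          (supDist x₁ (ctr j y) : ℝ) + ((P.L : ℝ) ^ j * (supDist y y' : ℝ) + (supDist x₂ (ctr j y') : ℝ)) := by
        exact_mod_cast t1.trans (Nat.add_le_add_left t2 _)
      have e1 : (distEU P j x₁ y + (supDist y y' : ℝ) + distEU P j x₂ y') * (P.L : ℝ) ^ j =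
          (supDist x₁ (ctr j y) : ℝ) + ((P.L : ℝ) ^ j * (supDist y y' : ℝ) + (supDist x₂ (ctr j y') : ℝ)) := by
        simp only [distEU]
        field_simp
        ring
      rw [e1]
      exact t3
    nlinarith [mul_le_mul_of_nonneg_right haδ h1, mul_le_mul_of_nonneg_right haδ h2, mul_le_mul_of_nonneg_right haC h3,
      mul_le_mul_of_nonneg_left htri ha.le]
  calc ∑ y : TSite P j, ∑ y' : TSite P j, Real.exp (-(δ * distEU P j x₁ y)) * Real.exp (-(δC * (supDist y y' : ℝ))) *
          Real.exp (-(δ * distEU P j x₂ y'))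
      ≤ ∑ y : TSite P j, ∑ y' : TSite P j,
          Real.exp (-(a * D)) * (Real.exp (-(a * distEU P j x₁ y)) * Real.exp (-(a * (supDist y y' : ℝ)))) :=
        Finset.sum_le_sum fun y _ => Finset.sum_le_sum fun y' _ => hpt y y'
    _ = Real.exp (-(a * D)) * ∑ y : TSite P j, ∑ y' : TSite P j,
          Real.exp (-(a * distEU P j x₁ y)) * Real.exp (-(a * (supDist y y' : ℝ))) := by
        rw [Finset.mul_sum]
        exact Finset.sum_congr rfl fun y _ => by rw [Finset.mul_sum]
    _ = Real.exp (-(a * D)) * ∑ y : TSite P j, Real.exp (-(a * distEU P j x₁ y)) *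
          ∑ y' : TSite P j, Real.exp (-(a * (supDist y y' : ℝ))) := by
        congr 1
        exact Finset.sum_congr rfl fun y _ => by rw [Finset.mul_sum]
    _ ≤ Real.exp (-(a * D)) * ∑ y : TSite P j, Real.exp (-(a * distEU P j x₁ y)) * (2 * (1 + P.d / a)) ^ P.d := by
        refine mul_le_mul_of_nonneg_left (Finset.sum_le_sum fun y _ => ?_) (Real.exp_pos _).le
        exact mul_le_mul_of_nonneg_left (sum_exp_neg_supDist_le ha hd y) (Real.exp_pos _).le
    _ = Real.exp (-(a * D)) * ((∑ y : TSite P j, Real.exp (-(a * distEU P j x₁ y))) * (2 * (1 + P.d / a)) ^ P.d) := by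
        rw [Finset.sum_mul]
    _ ≤ Real.exp (-(a * D)) * ((Real.exp (a / 2) * (2 * (1 + P.d / a)) ^ P.d) * (2 * (1 + P.d / a)) ^ P.d) := by
        refine mul_le_mul_of_nonneg_left (mul_le_mul_of_nonneg_right (sum_exp_neg_distEU_le hj ha x₁) (by positivity))
          (Real.exp_pos _).le
    _ = Real.exp (a / 2) * ((2 * (1 + P.d / a)) ^ P.d) ^ 2 * Real.exp (-(a * D)) := by ring

/-! ## §4  The scale-`j` term -/

/-- `|(QF)(c)| ≤ D` when `|F| ≤ D` ON THE CELLS OF `c` (`|B(c)| = L^{d−m}`). [cite: BalabanImbrieJaffe1985, (2.21) p.305] -/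
theorem abs_cellsQ_le_of_mem (G : Cells) (hcard : ∀ c : G.C, (G.B c).card = G.L ^ (G.d - G.m)) {F : G.F → ℝ} {D : ℝ}
    (c : G.C) (hF : ∀ p ∈ G.B c, |F p| ≤ D) : |G.Q F c| ≤ D := by
  unfold Cells.Q
  have hL : (0 : ℝ) < (G.L : ℝ) ^ (G.d - G.m) := pow_pos (by exact_mod_cast G.one_le_L) _
  rw [abs_mul, abs_inv, abs_of_pos hL]
  have hsum : |∑ p ∈ G.B c, F p| ≤ (G.B c).card • D :=
    (Finset.abs_sum_le_sum_abs _ _).trans (Finset.sum_le_card_nsmul _ _ _ hF)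
  rw [nsmul_eq_mul, hcard, Nat.cast_pow] at hsum
  calc ((G.L : ℝ) ^ (G.d - G.m))⁻¹ * |∑ p ∈ G.B c, F p|
      ≤ ((G.L : ℝ) ^ (G.d - G.m))⁻¹ * ((G.L : ℝ) ^ (G.d - G.m) * D) := mul_le_mul_of_nonneg_left hsum (inv_nonneg.2 hL.le)
    _ = D := by rw [← mul_assoc, inv_mul_cancel₀ hL.ne', one_mul]

/-- `L^k = L^j·L^{k−j}` for `j ≤ k`. [folklore] -/
private theorem pow_eq_pow_mul_pow {j k : ℕ} (hjk : j ≤ k) : (P.L : ℝ) ^ k = (P.L : ℝ) ^ j * (P.L : ℝ) ^ (k - j) := by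
  rw [← pow_add, Nat.add_sub_cancel' hjk]

/-- **THE COORDINATES OF `u^{(j)}_p` ARE EXPONENTIALLY SMALL AWAY FROM THE BLOCK OF `p`**: `|u^{(j)}_p(b)| ≤
(w·η^{−d})·(|c|/L^j)·2M·e^{δL^{k−j}}·e^{−δ|y_p − b₋|}`, `y_p = ctr k p₋` the centre of the block of `p` — the edge average over the face
`B^e_k(p)` (`adjoint_HkE_coord`) of the column bounds §2; the face has diameter `≤ L^k` fine steps `= L^{k−j}` in the unit of `T^{(j)}` (the
factor `e^{δL^{k−j}}`). [cite: BalabanImbrieJaffe1988, (2.16) p.261] -/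
theorem abs_coord_le (hd : 2 ≤ P.d) {k : ℕ} (hk : k ≤ P.m + P.K) {j : ℕ} (hj : j ≤ P.m + P.K) (hjk : j ≤ k) {c : ℝ} (hc : c ≠ 0)
    {w : ℝ} (hw : 0 < w) {a : ℝ} (ha : 0 < a) {δ M : ℝ} (hδ : 0 ≤ δ)
    (hB : ∀ (μ ν : Fin P.d) (x : TSite P 0) (y : TSite P j),
      ‖fun lam : Fin P.d => (P.L : ℝ) ^ j *
          ((torusRep P j (deltaAData hj a)).H (x.shift lam, μ) (y, ν) - (torusRep P j (deltaAData hj a)).H (x, μ) (y, ν))‖ ≤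
        M * Real.exp (-(δ * distEU P j x y)))
    (p : TPlaq P k) (b : PBond P j) :
    |LinearMap.adjoint (HkE P w c j)
        (LinearMap.adjoint (curlOp (P := P) w c) (QesOp (P := P) hd w k (toU P k (Pi.single p 1)))) b| ≤
      w * ((P.eta k)⁻¹) ^ P.d * (|c| / (P.L : ℝ) ^ j * (2 * M) * Real.exp (δ * (P.L : ℝ) ^ (k - j))) *
        Real.exp (-(δ * distEU P j (ctr k p.src) b.src)) := by
  have hM : 0 ≤ M := by
    have h := hB ⟨0, P.hd⟩ ⟨0, P.hd⟩ default default
    exact (mul_nonneg_iff_of_pos_right (Real.exp_pos _)).1 ((norm_nonneg _).trans h)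
  have hwη : 0 ≤ w * ((P.eta k)⁻¹) ^ P.d := (mul_pos hw (pow_pos (inv_pos.2 (eta_pos P k)) _)).le
  rw [adjoint_HkE_coord hd hk hw.le c j p b, abs_mul, abs_of_nonneg hwη, mul_assoc (w * ((P.eta k)⁻¹) ^ P.d)]
  refine mul_le_mul_of_nonneg_left ?_ hwη
  refine abs_cellsQ_le_of_mem (torusEdgeCellsTo P 0 k k (Nat.zero_add k) hd) (fun c => ?_) p (fun q hq => ?_)
  · rw [show (torusEdgeCellsTo P 0 k k (Nat.zero_add k) hd).L = P.L ^ k from rfl,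
      show (torusEdgeCellsTo P 0 k k (Nat.zero_add k) hd).d = P.d from rfl,
      show (torusEdgeCellsTo P 0 k k (Nat.zero_add k) hd).m = 2 from rfl]
    exact card_edgeBTo (P := P) (i := 0) (Nat.zero_add k) hk hd c
  · refine (abs_curl_col_le hj hc hw ha hB c q b).trans ?_
    rw [mul_assoc (|c| / (P.L : ℝ) ^ j * (2 * M)), ← Real.exp_add]
    refine mul_le_mul_of_nonneg_left (Real.exp_le_exp.2 ?_) (by positivity)
    -- `|q₋ − b₋| ≥ |y_p − b₋| − L^{k−j}`
    have h1 := distEU_sub_le j q.src (ctr k p.src) b.src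
    have h2 : (supDist q.src (ctr k p.src) : ℝ) / (P.L : ℝ) ^ j ≤ (P.L : ℝ) ^ (k - j) := by
      rw [div_le_iff₀ (cast_pow_L_pos' j), mul_comm, ← pow_eq_pow_mul_pow hjk]
      have h3 := supDist_ctr_le_of_mem hd hk hq
      have h4 : supDist q.src (ctr k p.src) ≤ P.L ^ k := h3.trans ((Nat.div_le_self _ _).trans (Nat.sub_le _ _))
      exact_mod_cast h4
    nlinarith [mul_le_mul_of_nonneg_left (h1.trans h2) hδ]

/-- a sum over the unit bonds of `T^{(j)}` of a function of the initial point is `d` times the sum over the sites. [folklore] -/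
private theorem sum_bond_src {j : ℕ} (f : TSite P j → ℝ) : ∑ b : PBond P j, f b.src = (P.d : ℝ) * ∑ y : TSite P j, f y := by
  rw [← Fintype.sum_equiv (LatticeFieldCalculus.bondEquiv (P := P) (j := j)) (fun q : TSite P j × Fin P.d => f q.1) _
    (fun q => rfl), Fintype.sum_prod_type]
  simp only [Finset.sum_const, Finset.card_univ, Fintype.card_fin, nsmul_eq_mul]
  rw [Finset.mul_sum]

/-- **THE SCALE-`j` TERM OF THE KERNEL IS EXPONENTIALLY SMALL**: `|Σ_{b,b′} u^{(j)}_{p₁}(b)C^{(j)}(b,b′)u^{(j)}_{p₂}(b′)| ≤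
(w·η^{−d})²(|c|/L^j)²4M²·M_C·e^{2δL^{k−j}}·d²e^{a/2}K(a)²·e^{−aL^{k−j}|p₁ − p₂|_∞}`, `a = min(δ, δ_C)/2` — the coordinate bounds `abs_coord_le`,
the (7.2.3)-shape bound for the matrix of `C^{(j)}`, and the three-kernel lattice sum `triple_sum_le` between the block centres, which are
`L^{k−j}|p₁ − p₂|_∞` apart in the unit of `T^{(j)}`. [cite: BalabanImbrieJaffe1988, (2.16) p.261] -/
theorem abs_term_le (hd : 2 ≤ P.d) {k : ℕ} (hk : k ≤ P.m + P.K) {j : ℕ} (hj : j ≤ P.m + P.K) (hjk : j ≤ k) {c : ℝ} (hc : c ≠ 0)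
    {w : ℝ} (hw : 0 < w) {a : ℝ} (ha : 0 < a) {δ M δC MC : ℝ} (hδ : 0 < δ) (hδC : 0 < δC)
    (hB : ∀ (μ ν : Fin P.d) (x : TSite P 0) (y : TSite P j),
      ‖fun lam : Fin P.d => (P.L : ℝ) ^ j *
          ((torusRep P j (deltaAData hj a)).H (x.shift lam, μ) (y, ν) - (torusRep P j (deltaAData hj a)).H (x, μ) (y, ν))‖ ≤
        M * Real.exp (-(δ * distEU P j x y)))
    (hC : ∀ b b' : PBond P j, |⟪toEj P j (Pi.single b 1), CE P w c j (toEj P j (Pi.single b' 1))⟫| ≤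
      MC * Real.exp (-(δC * (supDist b.src b'.src : ℝ))))
    (p₁ p₂ : TPlaq P k) :
    |∑ b : PBond P j, ∑ b' : PBond P j,
        LinearMap.adjoint (HkE P w c j)
            (LinearMap.adjoint (curlOp (P := P) w c) (QesOp (P := P) hd w k (toU P k (Pi.single p₁ 1)))) b *
          ⟪toEj P j (Pi.single b 1), CE P w c j (toEj P j (Pi.single b' 1))⟫ *
          LinearMap.adjoint (HkE P w c j)
            (LinearMap.adjoint (curlOp (P := P) w c) (QesOp (P := P) hd w k (toU P k (Pi.single p₂ 1)))) b'| ≤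
      (w * ((P.eta k)⁻¹) ^ P.d * (|c| / (P.L : ℝ) ^ j * (2 * M) * Real.exp (δ * (P.L : ℝ) ^ (k - j)))) ^ 2 * MC *
        ((P.d : ℝ) ^ 2 * (Real.exp (min δ δC / 2 / 2) * ((2 * (1 + P.d / (min δ δC / 2))) ^ P.d) ^ 2)) *
        Real.exp (-(min δ δC / 2 * ((P.L : ℝ) ^ (k - j) * (supDist p₁.src p₂.src : ℝ)))) := by
  set E : ℝ := w * ((P.eta k)⁻¹) ^ P.d * (|c| / (P.L : ℝ) ^ j * (2 * M) * Real.exp (δ * (P.L : ℝ) ^ (k - j))) with hE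
  have hMC : 0 ≤ MC := by
    have h := hC ⟨default, ⟨0, P.hd⟩⟩ ⟨default, ⟨0, P.hd⟩⟩
    exact (mul_nonneg_iff_of_pos_right (Real.exp_pos _)).1 ((abs_nonneg _).trans h)
  have hE0 : 0 ≤ E := by
    rw [hE]
    exact (mul_nonneg_iff_of_pos_right (Real.exp_pos _)).1
      ((abs_nonneg _).trans (abs_coord_le hd hk hj hjk hc hw ha hδ.le hB p₁ ⟨default, ⟨0, P.hd⟩⟩))
  set x₁ := ctr k p₁.src with hx₁
  set x₂ := ctr k p₂.src with hx₂
  -- termwise bound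
  have hpt : ∀ b b' : PBond P j,
      |LinearMap.adjoint (HkE P w c j)
            (LinearMap.adjoint (curlOp (P := P) w c) (QesOp (P := P) hd w k (toU P k (Pi.single p₁ 1)))) b *
          ⟪toEj P j (Pi.single b 1), CE P w c j (toEj P j (Pi.single b' 1))⟫ *
          LinearMap.adjoint (HkE P w c j)
            (LinearMap.adjoint (curlOp (P := P) w c) (QesOp (P := P) hd w k (toU P k (Pi.single p₂ 1)))) b'| ≤
        E ^ 2 * MC * (Real.exp (-(δ * distEU P j x₁ b.src)) * Real.exp (-(δC * (supDist b.src b'.src : ℝ))) *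
          Real.exp (-(δ * distEU P j x₂ b'.src))) := by
    intro b b'
    rw [abs_mul, abs_mul]
    have h1 := abs_coord_le hd hk hj hjk hc hw ha hδ.le hB p₁ b
    have h2 := abs_coord_le hd hk hj hjk hc hw ha hδ.le hB p₂ b'
    have h3 := hC b b'
    rw [← hE] at h1 h2
    calc _ ≤ (E * Real.exp (-(δ * distEU P j x₁ b.src))) * (MC * Real.exp (-(δC * (supDist b.src b'.src : ℝ)))) *
          (E * Real.exp (-(δ * distEU P j x₂ b'.src))) :=
          mul_le_mul (mul_le_mul h1 h3 (abs_nonneg _) (by positivity)) h2 (abs_nonneg _) (by positivity)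
      _ = _ := by ring
  calc _ ≤ ∑ b : PBond P j, ∑ b' : PBond P j, E ^ 2 * MC * (Real.exp (-(δ * distEU P j x₁ b.src)) *
          Real.exp (-(δC * (supDist b.src b'.src : ℝ))) * Real.exp (-(δ * distEU P j x₂ b'.src))) :=
        (Finset.abs_sum_le_sum_abs _ _).trans (Finset.sum_le_sum fun b _ =>
          (Finset.abs_sum_le_sum_abs _ _).trans (Finset.sum_le_sum fun b' _ => hpt b b'))
    _ = E ^ 2 * MC * ((P.d : ℝ) * ∑ y : TSite P j, (P.d : ℝ) * ∑ y' : TSite P j, Real.exp (-(δ * distEU P j x₁ y)) *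
          Real.exp (-(δC * (supDist y y' : ℝ))) * Real.exp (-(δ * distEU P j x₂ y'))) := by
        rw [← sum_bond_src (fun y => (P.d : ℝ) * ∑ y' : TSite P j, Real.exp (-(δ * distEU P j x₁ y)) *
          Real.exp (-(δC * (supDist y y' : ℝ))) * Real.exp (-(δ * distEU P j x₂ y'))), Finset.mul_sum]
        refine Finset.sum_congr rfl fun b _ => ?_
        rw [← sum_bond_src (fun y' => Real.exp (-(δ * distEU P j x₁ b.src)) * Real.exp (-(δC * (supDist b.src y' : ℝ))) *
          Real.exp (-(δ * distEU P j x₂ y'))), Finset.mul_sum]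
    _ = E ^ 2 * MC * (P.d : ℝ) ^ 2 * ∑ y : TSite P j, ∑ y' : TSite P j, Real.exp (-(δ * distEU P j x₁ y)) *
          Real.exp (-(δC * (supDist y y' : ℝ))) * Real.exp (-(δ * distEU P j x₂ y')) := by
        rw [← Finset.mul_sum]; ring
    _ ≤ E ^ 2 * MC * (P.d : ℝ) ^ 2 * (Real.exp (min δ δC / 2 / 2) * ((2 * (1 + P.d / (min δ δC / 2))) ^ P.d) ^ 2 *
          Real.exp (-(min δ δC / 2 * ((supDist x₁ x₂ : ℝ) / (P.L : ℝ) ^ j)))) :=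
        mul_le_mul_of_nonneg_left (triple_sum_le hj hδ hδC x₁ x₂) (by positivity)
    _ = _ := by rw [hx₁, hx₂, supDist_ctr_ctr_div hjk hk]; ring

/-! ## §5  The multiscale sum: «the rapid decay of the terms with small j compensates for the scaling factors» -/

/-- **the scaling factor against the scale-`j` decay**: `L^{2n}e^{−aL^n} ≤ 6/(a³L^n)` (`a > 0`; `x³/3! ≤ e^x`). [folklore] -/
private theorem scaleFactor_le {a : ℝ} (ha : 0 < a) (n : ℕ) :
    ((P.L : ℝ) ^ n) ^ 2 * Real.exp (-(a * (P.L : ℝ) ^ n)) ≤ 6 / (a ^ 3 * (P.L : ℝ) ^ n) := by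
  have hx : 0 < (P.L : ℝ) ^ n := cast_pow_L_pos' n
  have h := Real.pow_div_factorial_le_exp (a * (P.L : ℝ) ^ n) (by positivity) 3
  rw [Nat.factorial, Nat.factorial, Nat.factorial, Nat.factorial] at h
  norm_num at h
  have h' : (a * (P.L : ℝ) ^ n) ^ 3 ≤ Real.exp (a * (P.L : ℝ) ^ n) * 6 := by
    rwa [div_le_iff₀ (by norm_num : (0 : ℝ) < 6)] at h
  rw [le_div_iff₀ (by positivity)]
  calc ((P.L : ℝ) ^ n) ^ 2 * Real.exp (-(a * (P.L : ℝ) ^ n)) * (a ^ 3 * (P.L : ℝ) ^ n)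
      = (a * (P.L : ℝ) ^ n) ^ 3 * Real.exp (-(a * (P.L : ℝ) ^ n)) := by ring
    _ ≤ Real.exp (a * (P.L : ℝ) ^ n) * 6 * Real.exp (-(a * (P.L : ℝ) ^ n)) :=
        mul_le_mul_of_nonneg_right h' (Real.exp_pos _).le
    _ = 6 * (Real.exp (a * (P.L : ℝ) ^ n) * Real.exp (-(a * (P.L : ℝ) ^ n))) := by ring
    _ = 6 := by rw [← Real.exp_add, add_neg_cancel, Real.exp_zero, mul_one]

/-- `Σ_{j<k} L^{−(k−j)} ≤ 1` (`L ≥ 2`). [folklore] -/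
private theorem sum_inv_pow_le_one (k : ℕ) : ∑ j ∈ Finset.range k, ((P.L : ℝ) ^ (k - j))⁻¹ ≤ 1 := by
  have hL1 : (1 : ℝ) < P.L := by exact_mod_cast P.hL.2
  have hL0 : (0 : ℝ) < P.L := by linarith
  set x : ℝ := (P.L : ℝ)⁻¹ with hx
  have hx0 : 0 ≤ x := by rw [hx]; positivity
  have hx1 : x < 1 := by rw [hx]; exact inv_lt_one_of_one_lt₀ hL1
  have hx2 : x ≤ 1 / 2 := by
    rw [hx]
    have : (2 : ℝ) ≤ P.L := by exact_mod_cast P.hL.2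
    exact (inv_le_inv₀ hL0 two_pos).2 this |>.trans (by norm_num)
  have hre : ∑ j ∈ Finset.range k, ((P.L : ℝ) ^ (k - j))⁻¹ = ∑ i ∈ Finset.range k, x ^ (i + 1) := by
    rw [← Finset.sum_range_reflect]
    refine Finset.sum_congr rfl fun i hi => ?_
    rw [Finset.mem_range] at hi
    rw [hx, inv_pow, show k - (k - 1 - i) = i + 1 by omega]
  rw [hre]
  have hgeom : ∑ i ∈ Finset.range k, x ^ (i + 1) = x * ((x ^ k - 1) / (x - 1)) := by
    rw [← geom_sum_eq hx1.ne k, Finset.mul_sum]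
    exact Finset.sum_congr rfl fun i _ => by ring
  rw [hgeom]
  have h1x : 0 < 1 - x := by linarith
  have hxk : 0 ≤ x ^ k := pow_nonneg hx0 k
  rw [show (x ^ k - 1) / (x - 1) = (1 - x ^ k) / (1 - x) by
    rw [← neg_sub 1 (x ^ k), ← neg_sub 1 x, neg_div_neg_eq]]
  rw [← mul_div_assoc, div_le_one h1x]
  nlinarith

/-- `|p₁ − p₂|_∞ > 0 ⇒ p₁ ≠ p₂`. [folklore] -/
private theorem ne_of_supDist_pos {k : ℕ} {p₁ p₂ : TPlaq P k} (h : 0 < supDist p₁.src p₂.src) : p₁ ≠ p₂ := by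
  rintro rfl
  rw [(supDist_eq_zero_iff _ _).2 rfl] at h
  exact lt_irrefl 0 h

/-- **(2.16) ON THE TORI, `ℓ^∞` block distance, explicit constants**: for p30's `σ_k = sigmaTorus hd w c k` and unit plaquettes `p₁, p₂`
with `D := |p₁₋ − p₂₋|_∞ ≥ 4δ/a + 2` (`a = min(δ, δ_C)/2`): `|σ_k(p₁, p₂)| ≤ (w·η^{−d})²(|c|/L^k)²·(24M²M_C·d²e^{a/2}K(a)²/a³)·e^{−(a/2)D}` —
given the gradient member of (7.2.2) for every `H_j`, `j < k` (constants `δ, M`) and (7.2.3) for the matrix of every `C^{(j)}`, `j < k`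
(constants `δ_C, M_C ≥ 0`): the scale-`j` term `abs_term_le` carries `(|c|/L^j)² = (|c|/L^k)²L^{2(k−j)}` (the two derivatives, print's
`(L^jη)^{−2}`) against `e^{2δL^{k−j}}e^{−aL^{k−j}D} ≤ e^{−aL^{k−j}}e^{−(a/2)D}`, and `Σ_{j<k} L^{2(k−j)}e^{−aL^{k−j}} ≤ 6/a³` — *"[The rapid decay of
the terms with small j compensates for the scaling factors (L^jη)^{−1}.]"*. [cite: BalabanImbrieJaffe1988, (2.16) p.261] -/
theorem abs_sigmaKernel_le (hd : 2 ≤ P.d) {k : ℕ} (hk : k ≤ P.m + P.K) {c : ℝ} (hc : c ≠ 0) {w : ℝ} (hw : 0 < w) {a : ℝ} (ha : 0 < a)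
    {δ M δC MC : ℝ} (hδ : 0 < δ) (hδC : 0 < δC) (hMC : 0 ≤ MC)
    (hB : ∀ (j : ℕ) (hj : j ≤ P.m + P.K), j < k → ∀ (μ ν : Fin P.d) (x : TSite P 0) (y : TSite P j),
      ‖fun lam : Fin P.d => (P.L : ℝ) ^ j *
          ((torusRep P j (deltaAData hj a)).H (x.shift lam, μ) (y, ν) - (torusRep P j (deltaAData hj a)).H (x, μ) (y, ν))‖ ≤
        M * Real.exp (-(δ * distEU P j x y)))
    (hC : ∀ j < k, ∀ b b' : PBond P j, |⟪toEj P j (Pi.single b 1), CE P w c j (toEj P j (Pi.single b' 1))⟫| ≤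
      MC * Real.exp (-(δC * (supDist b.src b'.src : ℝ))))
    {p₁ p₂ : TPlaq P k} (hD : 4 * δ / (min δ δC / 2) + 2 ≤ (supDist p₁.src p₂.src : ℝ)) :
    |sigmaTorus (P := P) hd w c k (toU P k (Pi.single p₂ 1)) p₁| ≤
      (w * ((P.eta k)⁻¹) ^ P.d) ^ 2 * (|c| / (P.L : ℝ) ^ k) ^ 2 *
        (24 * M ^ 2 * MC * ((P.d : ℝ) ^ 2 * (Real.exp (min δ δC / 2 / 2) * ((2 * (1 + P.d / (min δ δC / 2))) ^ P.d) ^ 2)) /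
          (min δ δC / 2) ^ 3) *
        Real.exp (-(min δ δC / 2 / 2 * (supDist p₁.src p₂.src : ℝ))) := by
  set a₀ : ℝ := min δ δC / 2 with ha₀
  have ha₀p : 0 < a₀ := by rw [ha₀]; exact half_pos (lt_min hδ hδC)
  set D : ℝ := (supDist p₁.src p₂.src : ℝ) with hDdef
  set K : ℝ := (P.d : ℝ) ^ 2 * (Real.exp (a₀ / 2) * ((2 * (1 + P.d / a₀)) ^ P.d) ^ 2) with hK
  set W : ℝ := w * ((P.eta k)⁻¹) ^ P.d with hW
  have hK0 : 0 ≤ K := by positivity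
  have hD0 : 0 ≤ D := Nat.cast_nonneg _
  have hD' : 4 * δ + 2 * a₀ ≤ a₀ * D := by
    have h := mul_le_mul_of_nonneg_left hD ha₀p.le
    have e : a₀ * (4 * δ / a₀ + 2) = 4 * δ + 2 * a₀ := by field_simp
    linarith
  -- `p₁ ≠ p₂`
  have hDpos : 0 < supDist p₁.src p₂.src := by
    have h : (0 : ℝ) < (supDist p₁.src p₂.src : ℝ) := lt_of_lt_of_le (by positivity) hD
    exact_mod_cast h
  have hne : p₁ ≠ p₂ := ne_of_supDist_pos hDpos
  rw [sigmaKernel_offDiag_eq_sum hd hk hc hw hne, abs_neg]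
  -- the scale-`j` term against the scaling factor
  have hterm : ∀ j ∈ Finset.range k,
      |∑ b : PBond P j, ∑ b' : PBond P j,
        LinearMap.adjoint (HkE P w c j)
            (LinearMap.adjoint (curlOp (P := P) w c) (QesOp (P := P) hd w k (toU P k (Pi.single p₁ 1)))) b *
          ⟪toEj P j (Pi.single b 1), CE P w c j (toEj P j (Pi.single b' 1))⟫ *
          LinearMap.adjoint (HkE P w c j)
            (LinearMap.adjoint (curlOp (P := P) w c) (QesOp (P := P) hd w k (toU P k (Pi.single p₂ 1)))) b'| ≤
        W ^ 2 * (|c| / (P.L : ℝ) ^ k) ^ 2 * (4 * M ^ 2 * MC * K) *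
          ((6 / (a₀ ^ 3 * (P.L : ℝ) ^ (k - j))) * Real.exp (-(a₀ / 2 * D))) := by
    intro j hjm
    have hjk : j < k := Finset.mem_range.1 hjm
    have hj : j ≤ P.m + P.K := by omega
    refine (abs_term_le hd hk hj hjk.le hc hw ha hδ hδC (hB j hj hjk) (hC j hjk) p₁ p₂).trans ?_
    set ℓ : ℝ := (P.L : ℝ) ^ (k - j) with hℓ
    have hℓ1 : 1 ≤ ℓ := one_le_pow₀ (by exact_mod_cast P.L_pos)
    have hℓ0 : 0 < ℓ := by linarith
    have hcj : |c| / (P.L : ℝ) ^ j = |c| / (P.L : ℝ) ^ k * ℓ := by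
      rw [pow_eq_pow_mul_pow hjk.le, ← hℓ, div_mul_eq_mul_div, mul_div_mul_right _ _ hℓ0.ne']
    have h1 : (W * (|c| / (P.L : ℝ) ^ j * (2 * M) * Real.exp (δ * ℓ))) ^ 2 * MC * K * Real.exp (-(a₀ * (ℓ * D))) =
        W ^ 2 * (|c| / (P.L : ℝ) ^ k) ^ 2 * (4 * M ^ 2 * MC * K) *
          (ℓ ^ 2 * (Real.exp (δ * ℓ) * Real.exp (δ * ℓ) * Real.exp (-(a₀ * (ℓ * D))))) := by
      rw [hcj]; ring
    have h2 : Real.exp (δ * ℓ) * Real.exp (δ * ℓ) * Real.exp (-(a₀ * (ℓ * D))) ≤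
        Real.exp (-(a₀ * ℓ)) * Real.exp (-(a₀ / 2 * D)) := by
      rw [← Real.exp_add, ← Real.exp_add, ← Real.exp_add]
      refine Real.exp_le_exp.2 ?_
      have h3 := mul_le_mul_of_nonneg_left hD' (show (0 : ℝ) ≤ ℓ - 1 / 2 by linarith)
      have e1 : a₀ * (ℓ * D) = ℓ * (a₀ * D) := by ring
      rw [e1]
      nlinarith [h3, hℓ1, hδ.le, ha₀p.le, hD0, mul_nonneg ha₀p.le hD0]
    have h4 := scaleFactor_le (P := P) ha₀p (k - j)
    rw [← hℓ] at h4
    rw [h1]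
    refine mul_le_mul_of_nonneg_left ?_ (by positivity)
    calc ℓ ^ 2 * (Real.exp (δ * ℓ) * Real.exp (δ * ℓ) * Real.exp (-(a₀ * (ℓ * D))))
        ≤ ℓ ^ 2 * (Real.exp (-(a₀ * ℓ)) * Real.exp (-(a₀ / 2 * D))) := mul_le_mul_of_nonneg_left h2 (by positivity)
      _ = ℓ ^ 2 * Real.exp (-(a₀ * ℓ)) * Real.exp (-(a₀ / 2 * D)) := by ring
      _ ≤ 6 / (a₀ ^ 3 * ℓ) * Real.exp (-(a₀ / 2 * D)) := mul_le_mul_of_nonneg_right h4 (Real.exp_pos _).le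
  calc _ ≤ ∑ j ∈ Finset.range k, W ^ 2 * (|c| / (P.L : ℝ) ^ k) ^ 2 * (4 * M ^ 2 * MC * K) *
          ((6 / (a₀ ^ 3 * (P.L : ℝ) ^ (k - j))) * Real.exp (-(a₀ / 2 * D))) :=
        (Finset.abs_sum_le_sum_abs _ _).trans (Finset.sum_le_sum hterm)
    _ = W ^ 2 * (|c| / (P.L : ℝ) ^ k) ^ 2 * (24 * M ^ 2 * MC * K / a₀ ^ 3) * Real.exp (-(a₀ / 2 * D)) *
          ∑ j ∈ Finset.range k, ((P.L : ℝ) ^ (k - j))⁻¹ := by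
        rw [Finset.mul_sum]
        refine Finset.sum_congr rfl fun j _ => ?_
        field_simp
        ring
    _ ≤ W ^ 2 * (|c| / (P.L : ℝ) ^ k) ^ 2 * (24 * M ^ 2 * MC * K / a₀ ^ 3) * Real.exp (-(a₀ / 2 * D)) * 1 :=
        mul_le_mul_of_nonneg_left (sum_inv_pow_le_one k) (by positivity)
    _ = _ := by rw [mul_one]

/-! ## §6  (2.16) on the tori -/

/-- **(2.16) ON THE TORI AT THE PRINTED NORMALISATION** (`w = η^d`, `c = η⁻¹ = L^k`), in the `ℓ¹` distance `pdist` of gen 6's files and the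
three-constant shape consumed by `BIJ88Ineq217GradKernel.abs_ineq217_gradKernel_torus_eta` / `BIJ88Ineq217Ineq722Torus`: for
`pdist p₁ p₂ ≥ d(4δ/a + 2)`, `|σ_k(p₁, p₂)| ≤ (24M²M_C·d²e^{a/2}K(a)²/a³)·e^{−(a/(2d))·pdist p₁ p₂}`, `a = min(δ, δ_C)/2` — given the gradient
member of (7.2.2) for every `H_j` and (7.2.3) for the matrix of every `C^{(j)}`, `j < k`; constants INDEPENDENT of `k` and of the volume.
[cite: BalabanImbrieJaffe1988, (2.16) p.261] -/
theorem decay216_torus_eta (hd : 2 ≤ P.d) {k : ℕ} (hk : k ≤ P.m + P.K) {a : ℝ} (ha : 0 < a) {δ M δC MC : ℝ} (hδ : 0 < δ)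
    (hδC : 0 < δC) (hMC : 0 ≤ MC)
    (hB : ∀ (j : ℕ) (hj : j ≤ P.m + P.K), j < k → ∀ (μ ν : Fin P.d) (x : TSite P 0) (y : TSite P j),
      ‖fun lam : Fin P.d => (P.L : ℝ) ^ j *
          ((torusRep P j (deltaAData hj a)).H (x.shift lam, μ) (y, ν) - (torusRep P j (deltaAData hj a)).H (x, μ) (y, ν))‖ ≤
        M * Real.exp (-(δ * distEU P j x y)))
    (hC : ∀ j < k, ∀ b b' : PBond P j, |⟪toEj P j (Pi.single b 1),
      CE P ((P.eta k) ^ P.d) ((P.L : ℝ) ^ k) j (toEj P j (Pi.single b' 1))⟫| ≤ MC * Real.exp (-(δC * (supDist b.src b'.src : ℝ))))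
    (p₁ p₂ : TPlaq P k) (hfar : (P.d : ℝ) * (4 * δ / (min δ δC / 2) + 2) ≤ pdist p₁ p₂) :
    |sigmaTorus (P := P) hd ((P.eta k) ^ P.d) ((P.L : ℝ) ^ k) k (toU P k (Pi.single p₂ 1)) p₁| ≤
      (24 * M ^ 2 * MC * ((P.d : ℝ) ^ 2 * (Real.exp (min δ δC / 2 / 2) * ((2 * (1 + P.d / (min δ δC / 2))) ^ P.d) ^ 2)) /
          (min δ δC / 2) ^ 3) *
        Real.exp (-(min δ δC / 2 / 2 / P.d) * pdist p₁ p₂) := by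
  have hd0 : (0 : ℝ) < P.d := by exact_mod_cast P.hd
  have hLk : (P.L : ℝ) ^ k ≠ 0 := (cast_pow_L_pos' k).ne'
  -- `ℓ¹ ≤ d·ℓ^∞`
  have h1 : pdist p₁ p₂ ≤ (P.d : ℝ) * (supDist p₁.src p₂.src : ℝ) := by
    unfold pdist
    exact_mod_cast tdist_le_mul_supDist p₁.src p₂.src
  have hD : 4 * δ / (min δ δC / 2) + 2 ≤ (supDist p₁.src p₂.src : ℝ) :=
    le_of_mul_le_mul_left (hfar.trans h1) hd0
  have h := abs_sigmaKernel_le hd hk hLk (pow_pos (eta_pos P k) _) ha hδ hδC hMC hB hC hD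
  rw [eta_pow_mul_eta_inv_pow, abs_of_pos (cast_pow_L_pos' k), div_self hLk, one_pow, one_mul, one_mul] at h
  refine h.trans (mul_le_mul_of_nonneg_left (Real.exp_le_exp.2 ?_) (by positivity))
  have ha₀ : 0 < min δ δC / 2 := half_pos (lt_min hδ hδC)
  rw [neg_mul, neg_le_neg_iff, div_mul_eq_mul_div, div_le_iff₀ hd0]
  nlinarith [mul_le_mul_of_nonneg_left h1 (half_pos ha₀).le]

/-- **the (7.2.3)-shape hypothesis of this file IS r15's typed (7.2.3)** `KernelData.Ineq723 M_C δ_C` for p09's torus carrier at scale `j`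
with its `C`-member taken to be THE MATRIX of p11's `C^{(j)} = CE P w c j` in the orthonormal basis of the `T^{(j)}` bond space (the carrier's
`|y − y′|` is the `ℓ^∞` distance of `T^{(j)}`, `torusRep_dY`). [cite: BalabanImbrieJaffe1985, (7.2.3) p.325] -/
theorem cBound_of_ineq723 {j : ℕ} (D : TorusData P j) (BondU : Type) (distEB : TSite P 0 → BondU → ℝ) (Dker : TSite P 0 → BondU → ℝ)
    {w c MC δC : ℝ}
    (h : (torusKernelData P j D BondU distEB
      (fun μ ν y y' => ⟪toEj P j (Pi.single (⟨y, μ⟩ : PBond P j) 1), CE P w c j (toEj P j (Pi.single (⟨y', ν⟩ : PBond P j) 1))⟫)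
      Dker).Ineq723 MC δC) :
    ∀ b b' : PBond P j, |⟪toEj P j (Pi.single b 1), CE P w c j (toEj P j (Pi.single b' 1))⟫| ≤
      MC * Real.exp (-(δC * (supDist b.src b'.src : ℝ))) :=
  fun b b' => h b.dir b'.dir b.src b'.src

/-- **(2.16) ON THE TORI FROM THE TYPED (7.2.2) AND (7.2.3), CONSTANTS UNIFORM IN `k`**: given r15's typed `KernelData.Ineq722` for p09's
torus kernel family `i ↦ torusKernelData P (lev i) (deltaAData …) …` whose scales cover the standing range (`∀ j ≤ m + K, ∃ i, lev i = j`), and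
(7.2.3)-shape constants `(M_C, δ_C)`: THERE ARE `R₀, c₀, δ′ > 0` such that FOR EVERY scale `k ≤ m + K` at which the matrices of the `C^{(j)}`,
`j < k`, obey (7.2.3) with `(M_C, δ_C)`, the kernel of p30's `σ_k` (printed normalisation) satisfies `|σ_k(p₁, p₂)| ≤ c₀e^{−δ′·pdist p₁ p₂}`
whenever `pdist p₁ p₂ ≥ R₀`. [cite: BalabanImbrieJaffe1988, (2.16) p.261] -/
theorem decay216_torus_of_ineq722 (hd : 2 ≤ P.d) {lev : ℕ → ℕ} (hlev : ∀ i, lev i ≤ P.m + P.K)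
    (hcov : ∀ j ≤ P.m + P.K, ∃ i, lev i = j) {a : ℝ} (ha : 0 < a) {BondU : ℕ → Type}
    {distEB : (i : ℕ) → TSite P 0 → BondU i → ℝ} {Cker : (i : ℕ) → Fin P.d → Fin P.d → TSite P (lev i) → TSite P (lev i) → ℝ}
    {Dker : (i : ℕ) → TSite P 0 → BondU i → ℝ}
    (h722 : KernelData.Ineq722
      (fun i => torusKernelData P (lev i) (deltaAData (hlev i) a) (BondU i) (distEB i) (Cker i) (Dker i)))
    {δC MC : ℝ} (hδC : 0 < δC) (hMC : 0 ≤ MC) :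
    ∃ R₀ c₀ δ' : ℝ, 0 < δ' ∧ 0 ≤ c₀ ∧ ∀ (k : ℕ) (hk : k ≤ P.m + P.K),
      (∀ j < k, ∀ b b' : PBond P j, |⟪toEj P j (Pi.single b 1),
        CE P ((P.eta k) ^ P.d) ((P.L : ℝ) ^ k) j (toEj P j (Pi.single b' 1))⟫| ≤ MC * Real.exp (-(δC * (supDist b.src b'.src : ℝ)))) →
      ∀ p₁ p₂ : TPlaq P k, R₀ ≤ pdist p₁ p₂ →
        |sigmaTorus (P := P) hd ((P.eta k) ^ P.d) ((P.L : ℝ) ^ k) k (toU P k (Pi.single p₂ 1)) p₁| ≤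
          c₀ * Real.exp (-δ' * pdist p₁ p₂) := by
  obtain ⟨δ, M, hδ, hM, hBall⟩ := exists_bound_of_ineq722 hlev h722
  have hd0 : (0 : ℝ) < P.d := by exact_mod_cast P.hd
  have ha₀ : 0 < min δ δC / 2 := half_pos (lt_min hδ hδC)
  refine ⟨(P.d : ℝ) * (4 * δ / (min δ δC / 2) + 2),
    24 * M ^ 2 * MC * ((P.d : ℝ) ^ 2 * (Real.exp (min δ δC / 2 / 2) * ((2 * (1 + P.d / (min δ δC / 2))) ^ P.d) ^ 2)) /
      (min δ δC / 2) ^ 3,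
    min δ δC / 2 / 2 / P.d, by positivity, by positivity, fun k hk hC p₁ p₂ hfar => ?_⟩
  refine decay216_torus_eta hd hk ha hδ hδC hMC (fun j hj hjk μ ν x y => ?_) hC p₁ p₂ hfar
  obtain ⟨i, hi⟩ := hcov j hj
  subst hi
  have h := hBall i μ ν x y
  rw [torusKernelData_gradH] at h
  exact (le_add_of_nonneg_left (abs_nonneg _)).trans h

/-- **(2.16) ON THE TORI GIVEN [6I] PROPOSITION 1.2 BY ITS TREE NAME AND (7.2.3)**: the same with the (7.2.2) input supplied by
`B5.Prop12Printed` for the torus carriers at all scales of the standing range (`levStd P i = min(i, m + K)`;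
`BIJ85Ineq722DeltaA.ineq722_deltaA_of_prop12Printed`). [cite: BalabanImbrieJaffe1988, (2.16) p.261] -/
theorem decay216_torus_of_prop12 (hd : 2 ≤ P.d) {a : ℝ} (ha : 0 < a)
    (h12 : B5.Prop12Printed (fun i => settingOf (torusRep P (levStd P i) (deltaAData (levStd_le i) a)) i))
    {δC MC : ℝ} (hδC : 0 < δC) (hMC : 0 ≤ MC) :
    ∃ R₀ c₀ δ' : ℝ, 0 < δ' ∧ 0 ≤ c₀ ∧ ∀ (k : ℕ) (hk : k ≤ P.m + P.K),
      (∀ j < k, ∀ b b' : PBond P j, |⟪toEj P j (Pi.single b 1),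
        CE P ((P.eta k) ^ P.d) ((P.L : ℝ) ^ k) j (toEj P j (Pi.single b' 1))⟫| ≤ MC * Real.exp (-(δC * (supDist b.src b'.src : ℝ)))) →
      ∀ p₁ p₂ : TPlaq P k, R₀ ≤ pdist p₁ p₂ →
        |sigmaTorus (P := P) hd ((P.eta k) ^ P.d) ((P.L : ℝ) ^ k) k (toU P k (Pi.single p₂ 1)) p₁| ≤
          c₀ * Real.exp (-δ' * pdist p₁ p₂) :=
  decay216_torus_of_ineq722 hd levStd_le (fun j hj => ⟨j, min_eq_left hj⟩) ha
    (ineq722_deltaA_of_prop12Printed (levStd P) levStd_le ha (fun _ => PUnit) (fun _ _ _ => 0) (fun _ _ _ _ _ => 0)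
      (fun _ _ _ => 0) h12) hδC hMC

/-! ## §7  (2.17) on the tori with (2.16) DISCHARGED: given only [6I] Proposition 1.2 by name and (7.2.3) -/

/-- the row sums of `e^{−a·pdist}` over the unit plaquettes of `T^{(k)}`: `Σ_{p₂} e^{−a·pdist(p₁,p₂)} ≤ d²(2(1 + a⁻¹))^d` (a plaquette is
determined by its source and two directions; `B3TorusRadialSums.sum_exp_neg_tdist_le`), uniformly in the volume. [cite: Balaban1983Higgs3, (2.15) p.427] -/
theorem sum_plaq_exp_neg_pdist_le {k : ℕ} {a : ℝ} (ha : 0 < a) (p₁ : TPlaq P k) :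
    ∑ p₂ : TPlaq P k, Real.exp (-a * pdist p₁ p₂) ≤ (P.d : ℝ) ^ 2 * (2 * (1 + a⁻¹)) ^ P.d := by
  classical
  set ι : TPlaq P k → TSite P k × Fin P.d × Fin P.d := fun p => (p.src, p.μ, p.ν) with hι
  have hinj : Function.Injective ι := by
    rintro ⟨x, μ, ν, h⟩ ⟨x', μ', ν', h'⟩ hq
    simp only [hι, Prod.mk.injEq] at hq
    obtain ⟨rfl, rfl, rfl⟩ := hq
    rfl
  set g : TSite P k × Fin P.d × Fin P.d → ℝ := fun t => Real.exp (-(a * (p₁.src.tdist t.1 : ℝ))) with hg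
  have h1 : ∑ p₂ : TPlaq P k, Real.exp (-a * pdist p₁ p₂) = ∑ p₂ : TPlaq P k, g (ι p₂) := by
    refine Finset.sum_congr rfl fun p₂ _ => ?_
    rw [hg, hι, pdist, neg_mul]
  have h2 : ∑ p₂ : TPlaq P k, g (ι p₂) = ∑ t ∈ Finset.univ.image ι, g t := by
    rw [Finset.sum_image fun x _ y _ h => hinj h]
  have h3 : ∑ t ∈ Finset.univ.image ι, g t ≤ ∑ t : TSite P k × Fin P.d × Fin P.d, g t :=
    Finset.sum_le_sum_of_subset_of_nonneg (Finset.subset_univ _) fun t _ _ => (Real.exp_pos _).le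
  have h4 : ∑ t : TSite P k × Fin P.d × Fin P.d, g t = (P.d : ℝ) ^ 2 * ∑ y : TSite P k, Real.exp (-(a * (p₁.src.tdist y : ℝ))) := by
    rw [Fintype.sum_prod_type, Finset.mul_sum]
    refine Finset.sum_congr rfl fun y _ => ?_
    rw [hg]
    dsimp only
    rw [Finset.sum_const, Finset.card_univ, Fintype.card_prod, Fintype.card_fin, nsmul_eq_mul]
    push_cast
    ring
  rw [h1, h2]
  refine h3.trans ?_
  rw [h4]
  exact mul_le_mul_of_nonneg_left (Balaban1983to89.B3TorusRadialSums.sum_exp_neg_tdist_le ha p₁.src) (by positivity)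

/-- **(2.17) ON THE TORI WITH ITS (2.16) INPUT DISCHARGED — given only [6I] Proposition 1.2 by its tree name and (7.2.3)**: there are `R₀` and
`C ≥ 0` such that at every scale `k ≤ m + K` at which the matrices of the `C^{(j)}`, `j < k`, obey (7.2.3) with `(M_C, δ_C)`: for every radius
`R ≥ R₀` with `2R < |T^{(k)}|` per direction, every `p₁` (`p₁.src = castSite z₁`) and every `f` that is a curl `∂A` on the box of radius `R`
about `p₁`, `|(σ_kf)(p₁)| ≤ C(1 + R)·‖f‖_∞` for p30's `σ_k = sigmaTorus hd η^d η⁻¹ k` — gen 7's `BIJ88Ineq217Ineq722Torus.abs_ineq217_ineq722_torus`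
(the p. 262 argument with the near part from (7.2.1)–(7.2.2)) fed with THIS FILE's (2.16) `decay216_torus_of_ineq722` and the plaquette row sums
`sum_plaq_exp_neg_pdist_le`, both from `B5.Prop12Printed` through `BIJ85Ineq722DeltaA.ineq722_deltaA_of_prop12Printed`.
[cite: BalabanImbrieJaffe1988, (2.17) p.262] -/
theorem ineq217_torus_of_prop12 (hd : 2 ≤ P.d) {a : ℝ} (ha : 0 < a)
    (h12 : B5.Prop12Printed (fun i => settingOf (torusRep P (levStd P i) (deltaAData (levStd_le i) a)) i))
    {δC MC : ℝ} (hδC : 0 < δC) (hMC : 0 ≤ MC) :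
    ∃ R₀ C : ℝ, 0 ≤ C ∧ ∀ (k : ℕ) (hk : k ≤ P.m + P.K),
      (∀ j < k, ∀ b b' : PBond P j, |⟪toEj P j (Pi.single b 1),
        CE P ((P.eta k) ^ P.d) ((P.L : ℝ) ^ k) j (toEj P j (Pi.single b' 1))⟫| ≤ MC * Real.exp (-(δC * (supDist b.src b'.src : ℝ)))) →
      ∀ (R : ℕ), R₀ ≤ R → 2 * R < P.sitesPerDir k → ∀ (p₁ : TPlaq P k) (z₁ : Fin P.d → ℤ), p₁.src = castSite z₁ →
      ∀ (f : TPlaq P k → ℝ) (A : VecField P k ℝ), (∀ p ∈ boxPlaqs (loOf z₁ R) (hiOf z₁ R), f p = curl 1 A p) →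
        |sigmaTorus (P := P) hd ((P.eta k) ^ P.d) ((P.L : ℝ) ^ k) k (toU P k f) p₁| ≤ C * (1 + R) * supNorm f := by
  have h722 := ineq722_deltaA_of_prop12Printed (levStd P) levStd_le ha (fun _ => PUnit) (fun _ _ _ => 0)
    (fun _ _ _ _ _ => 0) (fun _ _ _ => 0) h12
  have hcov : ∀ j ≤ P.m + P.K, ∃ i, levStd P i = j := fun j hj => ⟨j, min_eq_left hj⟩
  obtain ⟨C₁, hC₁, h217⟩ := abs_ineq217_ineq722_torus hd levStd_le ha h722
  obtain ⟨R₀, c₀, δ', hδ', hc₀, h216⟩ := decay216_torus_of_ineq722 hd levStd_le hcov ha h722 hδC hMC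
  set S : ℝ := (P.d : ℝ) ^ 2 * (2 * (1 + δ'⁻¹)) ^ P.d with hS
  have hS0 : 0 ≤ S := by positivity
  have hd1 : (0 : ℝ) ≤ ((P.d - 1 : ℕ) : ℝ) := Nat.cast_nonneg _
  refine ⟨R₀, 2 * C₁ * ((P.d - 1 : ℕ) : ℝ) + c₀ * S * (1 + 8 * ((P.d - 1 : ℕ) : ℝ)), by positivity, ?_⟩
  intro k hk hCk R hR0 hR p₁ z₁ h₁ f A hf
  obtain ⟨i, hi⟩ := hcov k hk
  subst hi
  have h216k := h216 (levStd P i) hk hCk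
  have main := h217 i c₀ δ' S hc₀ R hR p₁ z₁ h₁ (fun p₂ hp => h216k p₁ p₂ (hR0.trans hp))
    (sum_plaq_exp_neg_pdist_le hδ' p₁) f A hf
  refine main.trans (mul_le_mul_of_nonneg_right ?_ (supNorm_nonneg f))
  have hR' : (0 : ℝ) ≤ R := Nat.cast_nonneg _
  push_cast
  nlinarith [mul_nonneg hC₁ hd1, mul_nonneg (mul_nonneg hc₀ hS0) hd1, mul_nonneg hC₁ (mul_nonneg hd1 hR'),
    mul_nonneg (mul_nonneg hc₀ hS0) hR']

end

end Literature.MathematicalPhysics.QuantumFieldTheory.BalabanImbrieJaffe1984to88.BIJ88Decay216Torus
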